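import Summits.QuantumFields.YangMills.Theses.ColdStartUniversality
import Literature.MathematicalPhysics.QuantumFieldTheory.Balaban1983to89.T4GenFunBounds
import Literature.MathematicalPhysics.QuantumFieldTheory.Balaban1983to89.T4ApexTwoLevel
import HarnessLib

/-!
# Route `ColdStartUniversality`, crux K_A1|Γ `NeutralColdStartMixing` (stmt-QuantumFields-27363), LINE 7
# «valley_averaging»: STUB 2 `ValleyCesaroMixing` (item 27404) CARRIES THE CHARGED SECTOR — it implies the cut-off-uniform
# Cesàro decay of the signed, basepoint-averaged unit Polyakov line along every cold-start solution

Helper file (seat `ym-line-csu-p1`, g14; `--supports stmt-QuantumFields-27363`).  The rev-3 line «centre-sector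
reduction» moved the crux from ALL loop strings (K_A1, 24809, whose kill-shape of record is «signed-Polyakov relaxation
time growing with the cut-off», instrument j298062 / idea-crit-5 NOTE 32c) to the CENTRE-EVEN strings (K_A1|Γ, 27363).
The registered line «valley_averaging» proves K_A1|Γ from `AdiabaticValleyTracking` (27403) and `ValleyCesaroMixing`
(27404); the latter asks cut-off-uniform Cesàro mixing, in total variation, of the VALLEY COORDINATE
`θ_K(V) = (|USite|⁻¹ Σ_x avgObs K (polyakov μ x) V)_μ` — and `θ_K` is CENTRE-ODD coordinatewise.  This file records the
exact consequence, kernel-checked: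

* ★ `signedPolyakov_cesaroDecay_of_valleyCesaroMixing` — `ValleyCesaroMixing` ⟹ for `γ ≤ γ₁` and every `δ > 0` there
  are a physical time `T₀` and `K₀` such that for ALL `K ≥ K₀`, every direction `μ`, every cold-start solution `U` of
  the step-`K` SZZ dynamics and every `T ≥ T₀`: `|T⁻¹ ∫₀ᵀ E[θ_K(U(s/ε_K))_μ] ds| ≤ δ`.  (Take `h := θ_K(·)_μ` in 27404: it is
  valley-measurable, `|h| ≤ 1`, and its Gibbs mean is `|USite|⁻¹ Σ_x expectAt K [polyakov μ x] = 0` by the exact centre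
  symmetry `T3CentreSymmetry.expectAt_eq_zero_of_odd_SU2`.)

So the charged-sector relaxation that rev 3 removed from the crux re-enters through stub 2 of its registered line: a
cut-off-GROWING signed-Polyakov relaxation time (the deciding instrument row B2b of `ADDENDUM-ym-csu-instr-1-g3.md §C`,
unfunded) would refute `ValleyCesaroMixing` as typed while leaving `NeutralColdStartMixing` untouched.  Custody
information for the planner / critic; nothing here proves or refutes a crux.  THEOREMS ONLY; RECORD-rung R3 plumbing; the
Yang–Mills mass gap is NOT proved.
-/

set_option autoImplicit false

noncomputable section

namespace Summit.QuantumFields.YangMills.Theorems.ColdStartUniversality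

open MeasureTheory
open scoped NNReal
open Literature.MathematicalPhysics.QuantumFieldTheory
open Literature.MathematicalPhysics.QuantumLattice (fundamentalRep continuous_fundamentalRep)
open Literature.MathematicalPhysics.QuantumFieldTheory.Balaban1983to89

/-- **The Gibbs mean of the signed, basepoint-averaged unit Polyakov line vanishes at every cut-off** (exact `Z₂` centre
symmetry of the step-`K` Wilson–Gibbs measure; `wind_μ (polyakov μ x) = 1` is odd). [cite: McLerranSvetitsky1981] -/
theorem integral_gibbs_signedPolyakov_eq_zero (F : T3ContinuumYM3Torus.T3Family) {γ : ℝ} (hγ : 0 < γ) (K : ℕ)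
    (μ : Fin 3) :
    ∫ V, (Fintype.card F.USite : ℝ)⁻¹ * ∑ x : F.USite,
        F.avgObs (ExpMeanLog.expMeanLogSU : LoopAverage (Matrix.specialUnitaryGroup (Fin 2) ℂ)) K
          (T3ContinuumYM3Torus.ULoop3.polyakov μ x) V
      ∂(T4GenFunBounds.gibbsMeasure (G := Matrix.specialUnitaryGroup (Fin 2) ℂ) (F.P K)
        ((F.scheme (ExpMeanLog.expMeanLogSU : LoopAverage (Matrix.specialUnitaryGroup (Fin 2) ℂ)) γ).β K)) = 0 := by
  have hβ : ∀ K', 0 ≤ (F.scheme (ExpMeanLog.expMeanLogSU : LoopAverage (Matrix.specialUnitaryGroup (Fin 2) ℂ)) γ).β K' :=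
    fun K' => F.scheme_β_nonneg _ hγ.le K'
  haveI := T4GenFunBounds.isProbabilityMeasure_gibbsMeasure (G := Matrix.specialUnitaryGroup (Fin 2) ℂ) (F.P K) (hβ K)
  have hm : ∀ (K' : ℕ) (C : T3ContinuumYM3Torus.ULoop3 F),
      Measurable (F.avgObs (ExpMeanLog.expMeanLogSU : LoopAverage (Matrix.specialUnitaryGroup (Fin 2) ℂ)) K' C) :=
    fun K' C => F.measurable_avgObs (F.avgMeasurable_of_measurableE _ T4ApexTwoLevel.measurableE_expMeanLogSU) K' C
  have hint : ∀ x : F.USite, Integrable (F.avgObs (ExpMeanLog.expMeanLogSU :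
      LoopAverage (Matrix.specialUnitaryGroup (Fin 2) ℂ)) K (T3ContinuumYM3Torus.ULoop3.polyakov μ x))
      (T4GenFunBounds.gibbsMeasure (G := Matrix.specialUnitaryGroup (Fin 2) ℂ) (F.P K)
        ((F.scheme (ExpMeanLog.expMeanLogSU : LoopAverage (Matrix.specialUnitaryGroup (Fin 2) ℂ)) γ).β K)) := fun x =>
    Integrable.mono' (integrable_const (1 : ℝ)) (hm K _).aestronglyMeasurable
      (ae_of_all _ fun V => by rw [Real.norm_eq_abs]; exact F.abs_avgObs_le_one _ K _ V)
  -- each single Polyakov line has Gibbs mean `expectAt K [polyakov μ x] = 0`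
  have hone : ∀ x : F.USite, ∫ V, F.avgObs (ExpMeanLog.expMeanLogSU :
      LoopAverage (Matrix.specialUnitaryGroup (Fin 2) ℂ)) K (T3ContinuumYM3Torus.ULoop3.polyakov μ x) V
      ∂(T4GenFunBounds.gibbsMeasure (G := Matrix.specialUnitaryGroup (Fin 2) ℂ) (F.P K)
        ((F.scheme (ExpMeanLog.expMeanLogSU : LoopAverage (Matrix.specialUnitaryGroup (Fin 2) ℂ)) γ).β K)) = 0 := by
    intro x
    have h0 := T3ContinuumYM3Torus.expectAt_eq_zero_of_odd_SU2 F
      (ExpMeanLog.expMeanLogSU : LoopAverage (Matrix.specialUnitaryGroup (Fin 2) ℂ)) γ (μ := μ) K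
      (Cs := [T3ContinuumYM3Torus.ULoop3.polyakov μ x]) (by simp [T3ContinuumYM3Torus.ULoop3.wind_polyakov])
    rw [T4GenFunBounds.expectAt_eq_integral_gibbs _ hβ K] at h0
    rw [← h0]
    refine integral_congr_ae (ae_of_all _ fun V => ?_)
    simp only [T4GenFunBounds.prodObs, List.map_cons, List.map_nil, List.prod_cons, List.prod_nil, mul_one]
    rfl
  rw [integral_const_mul, integral_finsetSum _ fun x _ => hint x]
  simp only [hone, Finset.sum_const_zero, mul_zero]

/-- ★ **`ValleyCesaroMixing` (LINE 7 stub 2, item 27404) CARRIES THE CHARGED SECTOR**: it implies the cut-off-uniform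
Cesàro decay to `0` of the signed, basepoint-averaged unit Polyakov line — in every direction `μ`, along every cold-start
solution of the step-`K` SZZ dynamics, for all `K ≥ K₀` with ONE physical time `T₀` — i.e. exactly the charged-sector
relaxation (kill-shape of record of the all-strings crux K_A1, stmt-QuantumFields-24809) that the rev-3 crux K_A1|Γ does
not ask. [cite: McLerranSvetitsky1981] -/
theorem signedPolyakov_cesaroDecay_of_valleyCesaroMixing
    (h : Summit.QuantumFields.YangMills.Theses.ColdStartUniversality.ValleyCesaroMixing) :
    ∃ γ₁ : ℝ, 0 < γ₁ ∧ ∀ (F : T3ContinuumYM3Torus.T3Family) (γ : ℝ), 0 < γ → γ ≤ γ₁ → ∀ (δ : ℝ), 0 < δ →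
      ∃ T₀ : ℝ, 0 < T₀ ∧ ∃ K₀ : ℕ, ∀ K : ℕ, K₀ ≤ K → ∀ (μ : Fin 3)
        (Ω : Type) (mΩ : MeasurableSpace Ω) (P : Measure Ω) (_ : IsProbabilityMeasure P)
        (W : ℝ≥0 → Ω → (Edge 3 ((F.P K).sitesPerDir 0) × NoiseIdx 2 → ℝ)) (hW : IsFlatBrownian W P)
        (U : ℝ≥0 → Ω → GaugeConfig 3 ((F.P K).sitesPerDir 0) (Matrix.specialUnitaryGroup (Fin 2) ℂ)),
        (∀ ω, U 0 ω = fun _ => 1) →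
        (latticeLangevinDynamics (⟨2, Literature.MathematicalPhysics.QuantumLattice.fundamentalRep (Fin 2),
            Literature.MathematicalPhysics.QuantumLattice.continuous_fundamentalRep _,
            Literature.MathematicalPhysics.QuantumLattice.fundamentalRep_injective _,
            Literature.MathematicalPhysics.QuantumLattice.fundamentalRep_mem_unitaryGroup⟩ :
            LatticeRep (Matrix.specialUnitaryGroup (Fin 2) ℂ)) ((γ * (F.P K).eps)⁻¹ / 2)).IsSolution
          (Literature.MathematicalPhysics.QuantumLattice.fundamentalRep (Fin 2)) hW.natFiltration P W U →
        ∀ T : ℝ, T₀ ≤ T →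
          |T⁻¹ * ∫ s in (0 : ℝ)..T, ∫ ω, (Fintype.card F.USite : ℝ)⁻¹ * ∑ x : F.USite,
              F.avgObs (ExpMeanLog.expMeanLogSU : LoopAverage (Matrix.specialUnitaryGroup (Fin 2) ℂ)) K
                (T3ContinuumYM3Torus.ULoop3.polyakov μ x)
                (fun b : PBond (F.P K) 0 => U (s / (F.P K).eps).toNNReal ω (b.src, b.dir)) ∂P| ≤ δ := by
  obtain ⟨γ₁, hγ₁, hmain⟩ := h
  refine ⟨γ₁, hγ₁, fun F γ hγ hγle δ hδ => ?_⟩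
  obtain ⟨T₀, hT₀, K₀, hK⟩ := hmain F γ hγ hγle δ hδ
  refine ⟨T₀, hT₀, K₀, fun K hKK μ Ω mΩ P hP W hW U hU0 hsol T hT => ?_⟩
  -- the observable `h := θ_K(·)_μ`
  have hm : ∀ (K' : ℕ) (C : T3ContinuumYM3Torus.ULoop3 F),
      Measurable (F.avgObs (ExpMeanLog.expMeanLogSU : LoopAverage (Matrix.specialUnitaryGroup (Fin 2) ℂ)) K' C) :=
    fun K' C => F.measurable_avgObs (F.avgMeasurable_of_measurableE _ T4ApexTwoLevel.measurableE_expMeanLogSU) K' C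
  have hsm : @StronglyMeasurable _ _ _ (MeasurableSpace.comap
      (fun (V : GaugeField (F.P K) 0 (Matrix.specialUnitaryGroup (Fin 2) ℂ)) (ν : Fin 3) =>
        (Fintype.card F.USite : ℝ)⁻¹ * ∑ x : F.USite,
          F.avgObs (ExpMeanLog.expMeanLogSU : LoopAverage (Matrix.specialUnitaryGroup (Fin 2) ℂ)) K
            (T3ContinuumYM3Torus.ULoop3.polyakov ν x) V) MeasurableSpace.pi)
      (fun V : GaugeField (F.P K) 0 (Matrix.specialUnitaryGroup (Fin 2) ℂ) =>
        (Fintype.card F.USite : ℝ)⁻¹ * ∑ x : F.USite,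
          F.avgObs (ExpMeanLog.expMeanLogSU : LoopAverage (Matrix.specialUnitaryGroup (Fin 2) ℂ)) K
            (T3ContinuumYM3Torus.ULoop3.polyakov μ x) V) := by
    have hθ : Measurable[MeasurableSpace.comap
        (fun (V : GaugeField (F.P K) 0 (Matrix.specialUnitaryGroup (Fin 2) ℂ)) (ν : Fin 3) =>
          (Fintype.card F.USite : ℝ)⁻¹ * ∑ x : F.USite,
            F.avgObs (ExpMeanLog.expMeanLogSU : LoopAverage (Matrix.specialUnitaryGroup (Fin 2) ℂ)) K
              (T3ContinuumYM3Torus.ULoop3.polyakov ν x) V) MeasurableSpace.pi]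
        (fun (V : GaugeField (F.P K) 0 (Matrix.specialUnitaryGroup (Fin 2) ℂ)) (ν : Fin 3) =>
          (Fintype.card F.USite : ℝ)⁻¹ * ∑ x : F.USite,
            F.avgObs (ExpMeanLog.expMeanLogSU : LoopAverage (Matrix.specialUnitaryGroup (Fin 2) ℂ)) K
              (T3ContinuumYM3Torus.ULoop3.polyakov ν x) V) :=
      Measurable.of_comap_le le_rfl
    exact ((@measurable_pi_apply (Fin 3) (fun _ => ℝ) _ μ).comp hθ).stronglyMeasurable
  have hbd : ∀ V : GaugeField (F.P K) 0 (Matrix.specialUnitaryGroup (Fin 2) ℂ),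
      |(Fintype.card F.USite : ℝ)⁻¹ * ∑ x : F.USite,
          F.avgObs (ExpMeanLog.expMeanLogSU : LoopAverage (Matrix.specialUnitaryGroup (Fin 2) ℂ)) K
            (T3ContinuumYM3Torus.ULoop3.polyakov μ x) V| ≤ 1 := by
    intro V
    rw [abs_mul, abs_inv, Nat.abs_cast]
    have hsum : |∑ x : F.USite, F.avgObs (ExpMeanLog.expMeanLogSU : LoopAverage (Matrix.specialUnitaryGroup (Fin 2) ℂ)) K
        (T3ContinuumYM3Torus.ULoop3.polyakov μ x) V| ≤ (Fintype.card F.USite : ℝ) := by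
      refine (Finset.abs_sum_le_sum_abs _ _).trans ?_
      have h1 : ∑ x : F.USite, |F.avgObs (ExpMeanLog.expMeanLogSU : LoopAverage (Matrix.specialUnitaryGroup (Fin 2) ℂ)) K
          (T3ContinuumYM3Torus.ULoop3.polyakov μ x) V| ≤ ∑ _x : F.USite, (1 : ℝ) :=
        Finset.sum_le_sum fun x _ => F.abs_avgObs_le_one _ K _ V
      simpa using h1
    by_cases hc : (Fintype.card F.USite : ℝ) = 0
    · rw [hc, inv_zero, zero_mul]; exact zero_le_one
    · have hpos : 0 < (Fintype.card F.USite : ℝ) := lt_of_le_of_ne (Nat.cast_nonneg _) (Ne.symm hc)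
      rw [inv_mul_le_iff₀ hpos, mul_one]
      exact hsum
  have hbd' : ∀ᵐ V ∂(T4GenFunBounds.gibbsMeasure (G := Matrix.specialUnitaryGroup (Fin 2) ℂ) (F.P K)
      ((F.scheme (ExpMeanLog.expMeanLogSU : LoopAverage (Matrix.specialUnitaryGroup (Fin 2) ℂ)) γ).β K)),
      |(Fintype.card F.USite : ℝ)⁻¹ * ∑ x : F.USite,
          F.avgObs (ExpMeanLog.expMeanLogSU : LoopAverage (Matrix.specialUnitaryGroup (Fin 2) ℂ)) K
            (T3ContinuumYM3Torus.ULoop3.polyakov μ x) V| ≤ 1 := ae_of_all _ hbd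
  have key := hK K hKK _ hsm hbd' Ω mΩ P hP W hW U hU0 hsol T hT
  rw [integral_gibbs_signedPolyakov_eq_zero F hγ K μ, zero_sub, abs_neg] at key
  exact key

end Summit.QuantumFields.YangMills.Theorems.ColdStartUniversality

end
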